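import Mathlib.Analysis.SpecialFunctions.PolarCoord
import Mathlib.Analysis.SpecialFunctions.Integrals.Basic
import Mathlib.MeasureTheory.Integral.Prod
import Mathlib.MeasureTheory.Measure.Lebesgue.Basic
import Literature.MathematicalPhysics.QuantumLattice.ScaleCutoffs
import HarnessLib

/-!
# Route `KLProgramme` — crux K3 `KLRegimeTwoPointLimit` (stmt-HubbardSuperconductivity-19937), support:
# the angular cancellation behind the zero-sound (Landau-channel) lemma of the Cooper/non-Cooper
# beta-function split (DECOMP App. E, Lemma E.2 — the week-1 kill test of crux C1 `BetaSplit`)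

Cell `gate-hubbard-kl`, seat p1 (C1 lead). Paper 2 of the KL programme replaces BGM 2006's sign-blind
running-coupling induction (3.65)–(3.70) by a channel-resolved one; its "why it might fail" is a
marginal Landau (zero-transfer particle–hole) channel at `T > 0`. Lemma E.2 says there is none in
BGM's radial `(k₀, e)` slicing: the zero-transfer particle–hole bubble of two single-scale propagators
is `O(γ^j)` per scale (plus a Poisson-summation remainder that is `O(γ^{N(h_β - j)})` away from the
thermal layer), because its leading term VANISHES IDENTICALLY. This file is the kernel-checked core
of that vanishing.

In the Benfatto–Giuliani–Mastropietro scheme the single-scale cutoff `f_h` of (2.28) is, up to an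
`O(γ^h)` remainder `f^R_h`, a function `f̃_h(√(k₀²(1+a)² + e²))` of the RADIUS in the plane of the
frequency `k₀` and the band energy `e = ε_h(k) - μ` ((2.43), (2.56bb)–(2.56d),
arXiv:cond-mat/0507686 pp. 10–11), while the propagator denominator is `-ik₀(1+a) + e`. BGM's
Lemma 2.2a ("the first integral is zero by oddity", (2.56e)) is the case `n = 1` of the following
elementary fact, PROVED here for every `n ≥ 1` and every weight `F` (no integrability hypothesis is
needed: Mathlib's polar-coordinates change of variables `integral_comp_polarCoord_symm` and
`setIntegral_prod_mul` are unconditional):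

  `∫∫ F(k₀² + e²) · (-i k₀ + e)^{-n} dk₀ de = 0`            (`klzs_integral_radial_mul_inv_pow_eq_zero`).

In polar coordinates `-i k₀ + e = -i r e^{iθ}`, so the angular integral is `∫_{-π}^{π} e^{-inθ} dθ = 0`.
The case `n = 2` is the continuum, frozen-dispersion, flat-Jacobian core of the **zero-sound
cancellation**: the particle–hole bubble at zero transfer built from two radial single-scale cutoffs
vanishes identically, for EVERY pair of scales (`klzs_zeroSound_radialShells_eq_zero`, stated with the
tree's `gnShell` of `Literature…ScaleCutoffs`); together with the support localisation of `gnShell`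
(`klzs_gnShell_mul_gnShell_eq_zero_of_le`: shells two or more scales apart do not overlap) this is what
makes the forward (Landau) couplings NOT flow scale by scale at `T > 0` in a radial `(k₀, e)` slicing —
the momentum-shell version of the statement is Dupuis–Chitov, Phys. Rev. B 54 (1996) 3040,
`dΓ^Ω/dt|_{ZS} = 0`. Also proved: the first-moment versions (an extra factor `k₀` or `e`, `n ≥ 2`:
the first-order Taylor terms of a slowly varying vertex insertion or of the level-set Jacobian cancel
as well — so the non-cancelling part is second order, `O(γ^{2j})`, resp. `O(γ^j · sup|∂ insertion|)`)
and the anisotropically rescaled version `k₀ ↦ b k₀`, `b ≠ 0` (BGM's `(1 + a_h)` of (2.43)).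

What is deliberately NOT here: the discrete Matsubara sum (Poisson-summation remainder and the
thermal layer `|j - h_β| = O(1)` where the bubble IS `O(1)`), the `E_h`-dependent remainders `f^R_h`,
`r_h`, the sector bookkeeping, and the version with momentum-dependent vertex insertions (which needs
first-moment bounds on the 4-leg increments — the one clause Lemma E.2 adds to the inductive hypothesis
(H_j) of App. E): those are estimates ABOUT this identity, written up in the cell note
`run/shared/lean/pub/gate-hubbard-kl/p1/E2-NOTE.md`.

## Sources

* G. Benfatto, A. Giuliani, V. Mastropietro, Ann. Henri Poincaré 7 (2006) 809–898, §2.5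
  Lemma 2.2a, (2.43), (2.56a)–(2.56e) (arXiv:cond-mat/0507686 pp. 10–11). [BenfattoGiulianiMastropietro2006]
* N. Dupuis, G. Y. Chitov, Phys. Rev. B 54 (1996) 3040 (arXiv:cond-mat/9511120), §II (the ZS graph
  does not renormalise `Γ^Ω` in the Kadanoff–Wilson–Shankar scheme; finite-`T` thermal factor).
-/

noncomputable section

-- the tree's namespace `Summit.<Summit>.<Problem>.Theorems` repeats the summit name by design (D-0017)
set_option linter.dupNamespace false

open Real Set MeasureTheory Complex
open scoped Real
open Literature.MathematicalPhysics.QuantumLattice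

namespace Summit.HubbardSuperconductivity.HubbardSuperconductivity.Theorems

/-! ### One-dimensional angular integrals -/

/-- `∫_{-π}^{π} e^{i m θ} dθ = 0` for every nonzero integer `m`. [folklore] -/
theorem klzs_integral_cexp_int_mul_I_eq_zero (m : ℤ) (hm : m ≠ 0) :
    ∫ θ in Ioo (-π) π, cexp ((m : ℂ) * I * θ) = 0 := by
  have hc : (m : ℂ) * I ≠ 0 := mul_ne_zero (Int.cast_ne_zero.mpr hm) I_ne_zero
  rw [← integral_Ioc_eq_integral_Ioo,
    ← intervalIntegral.integral_of_le (by linarith [pi_pos] : (-π : ℝ) ≤ π),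
    integral_exp_mul_complex hc]
  have h2 : cexp ((m : ℂ) * I * (π : ℝ)) = cexp ((m : ℂ) * I * ((-π : ℝ) : ℂ)) := by
    rw [show (m : ℂ) * I * ((π : ℝ) : ℂ) = (m : ℂ) * I * ((-π : ℝ) : ℂ) + m * (2 * π * I) by
      push_cast; ring, Complex.exp_add, exp_int_mul_two_pi_mul_I, mul_one]
  rw [h2, sub_self, zero_div]

/-- `∫_{-π}^{π} e^{-i n θ} dθ = 0` for every positive natural number `n`. [folklore] -/
theorem klzs_integral_cexp_neg_nat_mul_I_eq_zero (n : ℕ) (hn : n ≠ 0) :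
    ∫ θ in Ioo (-π) π, cexp (-(n : ℂ) * I * θ) = 0 := by
  have h := klzs_integral_cexp_int_mul_I_eq_zero (-(n : ℤ)) (by omega)
  push_cast at h
  exact h

/-- `∫_{-π}^{π} cos θ · e^{i m θ} dθ = 0` unless `m = ±1`. [folklore] -/
theorem klzs_integral_cos_mul_cexp_int_mul_I_eq_zero (m : ℤ) (hm : m ≠ 1) (hm' : m ≠ -1) :
    ∫ θ in Ioo (-π) π, (Real.cos θ : ℂ) * cexp ((m : ℂ) * I * θ) = 0 := by
  have hpt : ∀ θ : ℝ, (Real.cos θ : ℂ) * cexp ((m : ℂ) * I * θ)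
      = (1 / 2 : ℂ) * cexp (((m + 1 : ℤ) : ℂ) * I * θ) + (1 / 2 : ℂ) * cexp (((m - 1 : ℤ) : ℂ) * I * θ) := by
    intro θ
    rw [Complex.ofReal_cos, show Complex.cos θ = (cexp (θ * I) + cexp (-θ * I)) / 2 by
      rw [← Complex.two_cos]; ring]
    push_cast
    rw [show ((m : ℂ) + 1) * I * θ = θ * I + (m : ℂ) * I * θ by ring,
      show ((m : ℂ) - 1) * I * θ = -θ * I + (m : ℂ) * I * θ by ring, Complex.exp_add, Complex.exp_add]
    ring
  simp_rw [hpt]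
  have hi : ∀ k : ℤ, IntegrableOn (fun θ : ℝ => (1 / 2 : ℂ) * cexp ((k : ℂ) * I * θ)) (Ioo (-π) π) := by
    intro k
    exact ((continuous_const.mul (Complex.continuous_exp.comp
      (continuous_const.mul Complex.continuous_ofReal))).integrableOn_Icc).mono_set Ioo_subset_Icc_self
  rw [integral_add (hi _) (hi _), integral_const_mul, integral_const_mul,
    klzs_integral_cexp_int_mul_I_eq_zero _ (by omega), klzs_integral_cexp_int_mul_I_eq_zero _ (by omega)]
  simp

/-- `∫_{-π}^{π} sin θ · e^{i m θ} dθ = 0` unless `m = ±1`. [folklore] -/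
theorem klzs_integral_sin_mul_cexp_int_mul_I_eq_zero (m : ℤ) (hm : m ≠ 1) (hm' : m ≠ -1) :
    ∫ θ in Ioo (-π) π, (Real.sin θ : ℂ) * cexp ((m : ℂ) * I * θ) = 0 := by
  have hpt : ∀ θ : ℝ, (Real.sin θ : ℂ) * cexp ((m : ℂ) * I * θ)
      = (I / 2) * cexp (((m - 1 : ℤ) : ℂ) * I * θ) + (-I / 2) * cexp (((m + 1 : ℤ) : ℂ) * I * θ) := by
    intro θ
    rw [Complex.ofReal_sin, show Complex.sin θ = (cexp (-θ * I) - cexp (θ * I)) * I / 2 by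
      rw [← Complex.two_sin]; ring]
    push_cast
    rw [show ((m : ℂ) + 1) * I * θ = θ * I + (m : ℂ) * I * θ by ring,
      show ((m : ℂ) - 1) * I * θ = -θ * I + (m : ℂ) * I * θ by ring, Complex.exp_add, Complex.exp_add]
    ring_nf
  simp_rw [hpt]
  have hi : ∀ (c : ℂ) (k : ℤ), IntegrableOn (fun θ : ℝ => c * cexp ((k : ℂ) * I * θ)) (Ioo (-π) π) := by
    intro c k
    exact ((continuous_const.mul (Complex.continuous_exp.comp
      (continuous_const.mul Complex.continuous_ofReal))).integrableOn_Icc).mono_set Ioo_subset_Icc_self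
  rw [integral_add (hi _ _) (hi _ _), integral_const_mul, integral_const_mul,
    klzs_integral_cexp_int_mul_I_eq_zero _ (by omega), klzs_integral_cexp_int_mul_I_eq_zero _ (by omega)]
  simp

/-! ### The polar form of the denominator -/

/-- `-i (r cos θ) + r sin θ = -i r e^{iθ}`: in the polar coordinates of the `(k₀, e)`-plane the
propagator denominator `-ik₀ + e` is `-i r e^{iθ}`. [folklore] -/
theorem klzs_neg_I_mul_polar_add_polar (r θ : ℝ) :
    (-I * ((r * Real.cos θ : ℝ) : ℂ) + ((r * Real.sin θ : ℝ) : ℂ)) = -I * r * cexp (θ * I) := by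
  rw [Complex.exp_mul_I]
  push_cast
  ring_nf
  rw [I_sq]
  ring

/-- `(r cos θ)² + (r sin θ)² = r²`. [folklore] -/
theorem klzs_polar_sq_add_sq (r θ : ℝ) : (r * Real.cos θ) ^ 2 + (r * Real.sin θ) ^ 2 = r ^ 2 := by
  rw [mul_pow, mul_pow, ← mul_add, Real.cos_sq_add_sin_sq, mul_one]

/-- The inverse power of the denominator in polar form:
`((-i r e^{iθ})^n)⁻¹ = ((-i r)^n)⁻¹ · e^{-inθ}`. [folklore] -/
theorem klzs_inv_pow_polar_denominator (r θ : ℝ) (n : ℕ) :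
    ((-I * r * cexp (θ * I)) ^ n)⁻¹ = ((-I * (r : ℂ)) ^ n)⁻¹ * cexp (-(n : ℂ) * I * θ) := by
  rw [mul_pow, mul_inv, ← Complex.exp_nat_mul, ← Complex.exp_neg]
  congr 1
  congr 1
  ring

/-! ### Factorisation through polar coordinates -/

/-- **Polar factorisation.** If, in polar coordinates, `r • Φ(r cos θ, r sin θ) = f(r) · g(θ)` with
`∫_{-π}^{π} g = 0`, then `∫∫ Φ = 0` — unconditionally in `Φ` (Mathlib's `integral_comp_polarCoord_symm`
and `setIntegral_prod_mul` carry no integrability hypotheses; a non-integrable `Φ` has integral `0`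
by convention on both sides). [folklore] -/
theorem klzs_integral_eq_zero_of_polar_factorisation (Φ : ℝ × ℝ → ℂ) (f g : ℝ → ℂ)
    (hg : ∫ θ in Ioo (-π) π, g θ = 0) (hΦ : ∀ p : ℝ × ℝ, p.1 • Φ (polarCoord.symm p) = f p.1 * g p.2) :
    ∫ p : ℝ × ℝ, Φ p = 0 := by
  rw [← integral_comp_polarCoord_symm, polarCoord_target,
    show (fun p : ℝ × ℝ => p.1 • Φ (polarCoord.symm p)) = fun p => f p.1 * g p.2 from funext hΦ,
    Measure.volume_eq_prod, setIntegral_prod_mul, hg, mul_zero]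

/-! ### The cancellation -/

/-- **Angular cancellation (all powers).** For every weight `F` of the squared radius and every
`n ≥ 1`, `∫∫ F(k₀² + e²) (-ik₀ + e)^{-n} dk₀ de = 0`. The case `n = 1` is the mechanism of BGM
2006 Lemma 2.2a (the tadpole `g^{(h)}_ω(0)` gains a factor `γ^h`); `n = 2` is the zero-sound
bubble. No hypothesis on `F`: if the integrand is not integrable both sides are Mathlib's `0`.
[cite: BenfattoGiulianiMastropietro2006, §2.5 Lemma 2.2a (2.56e)] -/
theorem klzs_integral_radial_mul_inv_pow_eq_zero (F : ℝ → ℂ) {n : ℕ} (hn : n ≠ 0) :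
    ∫ p : ℝ × ℝ, F (p.1 ^ 2 + p.2 ^ 2) * ((-I * p.1 + p.2) ^ n)⁻¹ = 0 := by
  refine klzs_integral_eq_zero_of_polar_factorisation _
    (fun r : ℝ => (r : ℂ) * (F (r ^ 2) * ((-I * (r : ℂ)) ^ n)⁻¹))
    (fun θ : ℝ => cexp (-(n : ℂ) * I * θ)) (klzs_integral_cexp_neg_nat_mul_I_eq_zero n hn) fun p => ?_
  simp only [polarCoord_symm_apply, Complex.real_smul]
  rw [klzs_polar_sq_add_sq, klzs_neg_I_mul_polar_add_polar, klzs_inv_pow_polar_denominator]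
  ring

/-- **First-moment cancellation, frequency factor.** For `n ≥ 2`,
`∫∫ F(k₀² + e²) · k₀ · (-ik₀ + e)^{-n} dk₀ de = 0` (the angular integral is
`∫ cos θ e^{-inθ} dθ = 0`): the first-order Taylor term in `k₀` of a slowly varying insertion
cancels too. [folklore] -/
theorem klzs_integral_radial_mul_fst_mul_inv_pow_eq_zero (F : ℝ → ℂ) {n : ℕ} (hn : 2 ≤ n) :
    ∫ p : ℝ × ℝ, F (p.1 ^ 2 + p.2 ^ 2) * p.1 * ((-I * p.1 + p.2) ^ n)⁻¹ = 0 := by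
  refine klzs_integral_eq_zero_of_polar_factorisation _
    (fun r : ℝ => (r : ℂ) * (r : ℂ) * (F (r ^ 2) * ((-I * (r : ℂ)) ^ n)⁻¹))
    (fun θ : ℝ => (Real.cos θ : ℂ) * cexp (((-(n : ℤ) : ℤ) : ℂ) * I * θ))
    (klzs_integral_cos_mul_cexp_int_mul_I_eq_zero _ (by omega) (by omega)) fun p => ?_
  simp only [polarCoord_symm_apply, Complex.real_smul]
  rw [klzs_polar_sq_add_sq, klzs_neg_I_mul_polar_add_polar, klzs_inv_pow_polar_denominator]
  push_cast
  ring

/-- **First-moment cancellation, energy factor.** For `n ≥ 2`,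
`∫∫ F(k₀² + e²) · e · (-ik₀ + e)^{-n} dk₀ de = 0` (the angular integral is
`∫ sin θ e^{-inθ} dθ = 0`): the first-order Taylor term in `e` of the level-set Jacobian or of an
insertion cancels too. [folklore] -/
theorem klzs_integral_radial_mul_snd_mul_inv_pow_eq_zero (F : ℝ → ℂ) {n : ℕ} (hn : 2 ≤ n) :
    ∫ p : ℝ × ℝ, F (p.1 ^ 2 + p.2 ^ 2) * p.2 * ((-I * p.1 + p.2) ^ n)⁻¹ = 0 := by
  refine klzs_integral_eq_zero_of_polar_factorisation _
    (fun r : ℝ => (r : ℂ) * (r : ℂ) * (F (r ^ 2) * ((-I * (r : ℂ)) ^ n)⁻¹))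
    (fun θ : ℝ => (Real.sin θ : ℂ) * cexp (((-(n : ℤ) : ℤ) : ℂ) * I * θ))
    (klzs_integral_sin_mul_cexp_int_mul_I_eq_zero _ (by omega) (by omega)) fun p => ?_
  simp only [polarCoord_symm_apply, Complex.real_smul]
  rw [klzs_polar_sq_add_sq, klzs_neg_I_mul_polar_add_polar, klzs_inv_pow_polar_denominator]
  push_cast
  ring

/-! ### Anisotropic rescaling of the frequency (BGM's `1 + a_h`) -/

/-- Rescaling the first coordinate by `b ≠ 0` multiplies a plane integral by `|b|⁻¹`; in
particular it preserves vanishing. Unconditional in the integrand (a measurable-equivalence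
change of variables). [folklore] -/
theorem klzs_integral_comp_mul_fst (G : ℝ × ℝ → ℂ) {b : ℝ} (hb : b ≠ 0) :
    ∫ p : ℝ × ℝ, G (b * p.1, p.2) = (ENNReal.ofReal |b⁻¹|).toReal • ∫ p : ℝ × ℝ, G p := by
  let e : ℝ × ℝ ≃ᵐ ℝ × ℝ := (MeasurableEquiv.mulLeft₀ b hb).prodCongr (MeasurableEquiv.refl ℝ)
  have he : ∀ p : ℝ × ℝ, e p = (b * p.1, p.2) := fun p => rfl
  have hmap : Measure.map e (volume : Measure (ℝ × ℝ)) = ENNReal.ofReal |b⁻¹| • volume := by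
    rw [show (e : ℝ × ℝ → ℝ × ℝ) = Prod.map (fun x : ℝ => b * x) id from funext fun p => rfl,
      Measure.volume_eq_prod, ← Measure.map_prod_map _ _ (measurable_const_mul b) measurable_id,
      Real.map_volume_mul_left hb, Measure.map_id, Measure.prod_smul_left]
  simp_rw [← he]
  rw [← integral_map_equiv e G, hmap, integral_smul_measure]

/-- **Angular cancellation with BGM's anisotropic frequency factor.** For `b ≠ 0` (BGM: `b = 1 + a_h(k)`,
`|a_h| ≤ C|U|`, (2.43)) and `n ≥ 1`: `∫∫ F(b²k₀² + e²) (-i b k₀ + e)^{-n} dk₀ de = 0`.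
[cite: BenfattoGiulianiMastropietro2006, §2.5 Lemma 2.2a (2.56e)] -/
theorem klzs_integral_radial_rescaled_mul_inv_pow_eq_zero (F : ℝ → ℂ) {b : ℝ} (hb : b ≠ 0) {n : ℕ} (hn : n ≠ 0) :
    ∫ p : ℝ × ℝ, F ((b * p.1) ^ 2 + p.2 ^ 2) * ((-I * (b * p.1 : ℝ) + p.2) ^ n)⁻¹ = 0 := by
  have h := klzs_integral_comp_mul_fst (fun q : ℝ × ℝ => F (q.1 ^ 2 + q.2 ^ 2) * ((-I * q.1 + q.2) ^ n)⁻¹) hb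
  simp only at h
  rw [klzs_integral_radial_mul_inv_pow_eq_zero F hn, smul_zero] at h
  exact h

/-! ### The single-scale shells of `ScaleCutoffs`: disjointness and the zero-sound bubble -/

variable {γ e₀ : ℝ}

/-- **Shells two or more scales apart do not overlap**: `f_h(t) · f_{h'}(t) = 0` for all `t` when
`h' ≤ h - 2` (the support of `f_h` is `(e₀γ^{h-2}, e₀γ^h)`, `ScaleCutoffs`). With a FROZEN dispersion
relation this is the statement that the zero-transfer particle–hole (and particle–particle) pairing of
the fields of scales `h`, `h'` vanishes identically unless `|h - h'| ≤ 1`.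
[cite: BenfattoGiulianiMastropietro2006, §2.3 (2.28)] -/
theorem klzs_gnShell_mul_gnShell_eq_zero_of_le (hγ : 1 < γ) (he : 0 < e₀) {h h' : ℤ} (hh : h' ≤ h - 2)
    (t : ℝ) : gnShell γ e₀ h t * gnShell γ e₀ h' t = 0 := by
  by_cases ht : t ≤ e₀ * γ ^ (h - 2)
  · rw [gnShell_eq_zero_of_le hγ he ht, zero_mul]
  · have h1 : e₀ * γ ^ h' ≤ t :=
      le_of_lt (lt_of_le_of_lt (mul_le_mul_of_nonneg_left
        ((zpow_le_zpow_iff_right₀ hγ).2 hh) he.le) (not_le.mp ht))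
    rw [gnShell_eq_zero_of_ge hγ he h1, mul_zero]

/-- **The zero-sound bubble of two radial shells vanishes (continuum, frozen dispersion, flat
Jacobian).** For ALL scales `j, j'` and any frequency rescaling `b ≠ 0`:
`∫∫ f_j(ρ) f_{j'}(ρ) (-i b k₀ + e)^{-2} dk₀ de = 0`, `ρ = √(b²k₀² + e²)`, `f = gnShell γ e₀`.
This is the leading term of the same-scale (`j' = j`) and adjacent-scale (`j' = j ± 1`)
particle–hole bubble at zero momentum-frequency transfer in BGM's slicing; all other pairs vanish
already by `klzs_gnShell_mul_gnShell_eq_zero_of_le`. [folklore] -/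
theorem klzs_zeroSound_radialShells_eq_zero (γ e₀ : ℝ) (j j' : ℤ) {b : ℝ} (hb : b ≠ 0) :
    ∫ p : ℝ × ℝ, ((gnShell γ e₀ j (Real.sqrt ((b * p.1) ^ 2 + p.2 ^ 2))
        * gnShell γ e₀ j' (Real.sqrt ((b * p.1) ^ 2 + p.2 ^ 2)) : ℝ) : ℂ)
        * ((-I * (b * p.1 : ℝ) + p.2) ^ 2)⁻¹ = 0 :=
  klzs_integral_radial_rescaled_mul_inv_pow_eq_zero
    (fun s : ℝ => ((gnShell γ e₀ j (Real.sqrt s) * gnShell γ e₀ j' (Real.sqrt s) : ℝ) : ℂ)) hb two_ne_zero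

/-- **The tadpole of a radial shell vanishes (continuum, frozen dispersion, flat Jacobian)** — the
abstract form of BGM 2006 Lemma 2.2a, (2.56e): `∫∫ f_j(√(b²k₀² + e²)) (-i b k₀ + e)^{-1} dk₀ de = 0`.
(The tree's `norm_sectorPropagator_zero_le` in `SectorPropagatorAtZero` is the model-bound
quantitative statement; this is its symmetry core in the radial variables.)
[cite: BenfattoGiulianiMastropietro2006, §2.5 Lemma 2.2a (2.56e)] -/
theorem klzs_tadpole_radialShell_eq_zero (γ e₀ : ℝ) (j : ℤ) {b : ℝ} (hb : b ≠ 0) :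
    ∫ p : ℝ × ℝ, ((gnShell γ e₀ j (Real.sqrt ((b * p.1) ^ 2 + p.2 ^ 2)) : ℝ) : ℂ)
        * ((-I * (b * p.1 : ℝ) + p.2) ^ 1)⁻¹ = 0 :=
  klzs_integral_radial_rescaled_mul_inv_pow_eq_zero
    (fun s : ℝ => ((gnShell γ e₀ j (Real.sqrt s) : ℝ) : ℂ)) hb one_ne_zero

end Summit.HubbardSuperconductivity.HubbardSuperconductivity.Theorems

end
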